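import Summits.QuantumFields.BalabanUV.Beta.SymBorderedHessianBlind
import Summits.QuantumFields.BalabanUV.Beta.BorderedHessianStepStraight

/-!
# `BalabanUV.Beta.SymBorderedHessianStepBlind` — binder row D1, JSB12SYM-SPINE v1.1 (Σ3) step K3 part a: THE DRESSING POTENTIAL OF A BOND INDICATOR
# UNDER `Π^{sym}_bm` IS SUPPORTED IN ONE BLOCK, A BOUNDED CO-CLOSED ROW IS REPRODUCED BY THE FIELD BLOCK OF `Π̂_sym`, and THE STRAIGHT STEP
# CANDIDATE `bhKStep d Lc (j+1)` IS BLIND TO THE SYMMETRISED DRESSING ON BOTH SIDES (pattern `ValueHessianBlind` §3–4 + `BorderedHessianStepStraight`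
# §5–6 verbatim; `tsum_mul_dz_eq_zero_of_codiff₁`, `comp_bhKStep_succ_inl∕inr`, `trK_bhKStep_succ` BY NAME)

CHART (RULING R-D1-g25-4): chart (II); hSX separate.
HONEST FRAMING (cell contract, verbatim): «discharging `BetaPertH` makes Bałaban's UV stability UNCONDITIONAL — a real constructive-QFT
result; it is NOT the continuum limit and NOT the Clay problem.»  THIS MODULE DISCHARGES NOTHING of `BetaPertH` ∕ row D1: [folklore] bookkeeping
of OUR objects.  0 sorry, 0 `def … : Prop`, nothing cited.  NOT HERE (K3 part b): the step absorption and `RelInv` at every step.  NOT D1, NOT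
BetaPertH, NOT continuum, NOT Clay.
HONEST DEPENDENCY (verbatim): «continuum YM on T⁴ ⇐ BetaPertH ∧ nine spine estimates (0/9 proved); BetaPertH ⇐ (D1) ∧ (D4) ∧ CAP+tail;
G-an2-4 gates asym, D1 and NE2/3/4.»  ABSOLUTE RULE (cell, verbatim): «No internally-minted statement may enter as a cited fact. Every
hypothesis is either kernel-proved in this package or a verbatim quotation of a PUBLISHED theorem with page reference.»
Unit `b2b-balaban-beta-an2` gen 25 (row-D1 owner), 2026-08-21.
-/

namespace Summit.QuantumFields.BalabanUV.Beta.SymBorderedHessianStepBlind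

noncomputable section

open Finset
open scoped BigOperators Nat
open Literature.Probability.LatticeModels (TorusSite Torus.proj Torus.proj_apply)
open Literature.MathematicalPhysics.QuantumFieldTheory
open Literature.MathematicalPhysics.QuantumFieldTheory.Balaban1983to89
open Literature.MathematicalPhysics.QuantumFieldTheory.Balaban1983to89.Beta
open ExpKernelCalculus (MKer comp)
open AffineAveraging (Form0 Form1 Form2 Site box toSite unitVec unitVec_apply dz curv curvAdj codiff₁ blockSum contourSum)
open AffineReproduction (contourSumAdj)
open AveragingContours (blk grad grad_eq_dz blk_block off off_mem_box blk_add_off)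
open AveragingContoursRooted (ctr ctrOff ctrOff_mem_box)
open KKTFluctuationKernel (delta1 delta1_apply)
open KKTFluctuationEnergy (summable_mul_of_bdd summable_dz)
open KernelSpecInstance (wΦ)
open OneStepResolventKernel (Fib)
open Summit.QuantumFields.BalabanUV.Beta.TameKernelCalculus
open Summit.QuantumFields.BalabanUV.Beta.AxialDressingRooted (cube mem_cube one_le_of_neZero)
open Summit.QuantumFields.BalabanUV.Beta.AxialProjectorBlockMean (blockMeanAt)
open Summit.QuantumFields.BalabanUV.Beta.BorderedHessian (bhK bhK_inl_inr bhK_inr_inl fcol mcol tsum_mul_dz_eq_zero_of_codiff₁ bhKStep bhKStep_succ_inl_inl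
  bhKStep_succ_inl_inr bhKStep_succ_inr_inl bhKStep_succ_inr_inr comp_bhKStep_succ_inl comp_bhKStep_succ_inr exists_abs_wΦ_le codiff₁_wΦ_right
  E2_inl_inl_eq_wΦ trK_bhKStep_succ sgnK comp_sgnK contourSumAdj_zero contourSum_zero)
open Summit.QuantumFields.BalabanUV.Beta.SymmetrisedAxialPotential
open Summit.QuantumFields.BalabanUV.Beta.SymmetrisedAxialGauge
open Summit.QuantumFields.BalabanUV.Beta.SymmetrisedAxialGaugeBlockMean
open Summit.QuantumFields.BalabanUV.Beta.SymmetrisedDressingMatrix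
open Summit.QuantumFields.BalabanUV.Beta.SymmetrisedDressingKernel
open Summit.QuantumFields.BalabanUV.Beta.SymSliceBlockMatrix (symTreeGaugeAt_congr symTreeGaugeAt_zero)
open Summit.QuantumFields.BalabanUV.Beta.SymBorderedHessianBlind

variable {d : ℕ}

/-! ## §1 The symmetrised dressing potential of a bond indicator lives in the bond's block -/

section Potential

variable {N : ℕ}

/-- [folklore] The symmetrised tree gauge of `δ_{(β,z)}` vanishes outside the block of `z` (in-block root: no contour of another block uses the bond). -/
theorem symTreeGaugeAt_delta1_eq_zero_of_blk_ne (hN : 1 ≤ N) {r : Fin (d + 1) → ℕ} (hr : r ∈ box (d + 1) N) {β : Fin (d + 1)}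
    {z p : Fin (d + 1) → ℤ} (h : blk N p ≠ blk N z) : symTreeGaugeAt (toSite r) (delta1 β z) N p = 0 := by
  rw [symTreeGaugeAt_congr hN hr (A' := (0 : Form1 (d + 1) ℝ))]
  · exact symTreeGaugeAt_zero _ _ _
  · intro κ w hw _
    rw [delta1_apply, Pi.zero_apply, Pi.zero_apply]
    split_ifs with hk
    · exact absurd (hk.2 ▸ hw) (Ne.symm h)
    · rfl

/-- [folklore] … hence so does the symmetrised gauge parameter … -/
theorem symGaugeAt_delta1_eq_zero_of_blk_ne (hN : 1 ≤ N) {r : Fin (d + 1) → ℕ} (hr : r ∈ box (d + 1) N) {β : Fin (d + 1)}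
    {z p : Fin (d + 1) → ℤ} (h : blk N p ≠ blk N z) : symGaugeAt (toSite r) (delta1 β z) N p = 0 := by
  simp only [symGaugeAt, symTreeGaugeAt_delta1_eq_zero_of_blk_ne hN hr h, mul_zero]

/-- [folklore] … and its block mean … -/
theorem blockMeanAt_symGaugeAt_delta1_eq_zero_of_blk_ne (hN : 1 ≤ N) {r : Fin (d + 1) → ℕ} (hr : r ∈ box (d + 1) N) {β : Fin (d + 1)}
    {z p : Fin (d + 1) → ℤ} (h : blk N p ≠ blk N z) : blockMeanAt N (symGaugeAt (toSite r) (delta1 β z) N) p = 0 := by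
  unfold blockMeanAt blockSum
  rw [Finset.sum_eq_zero, zero_div]
  intro b hb
  exact symGaugeAt_delta1_eq_zero_of_blk_ne hN hr (by rw [blk_block (blk N p) hb]; exact h)

/-- [folklore] **THE SYMMETRISED DRESSING POTENTIAL `symBmGaugeAt ρ δ_{(β,z)} N` VANISHES OUTSIDE THE BLOCK OF THE BOND.** -/
theorem symBmGaugeAt_delta1_eq_zero_of_blk_ne (hN : 1 ≤ N) {r : Fin (d + 1) → ℕ} (hr : r ∈ box (d + 1) N) {β : Fin (d + 1)}
    {z p : Fin (d + 1) → ℤ} (h : blk N p ≠ blk N z) : symBmGaugeAt (toSite r) (delta1 β z) N p = 0 := by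
  unfold symBmGaugeAt
  rw [Pi.sub_apply, symGaugeAt_delta1_eq_zero_of_blk_ne hN hr h, blockMeanAt_symGaugeAt_delta1_eq_zero_of_blk_ne hN hr h, sub_zero]

/-- [folklore] **THE SYMMETRISED DRESSING POTENTIAL OF A BOND INDICATOR IS SUMMABLE** (finitely supported). -/
theorem summable_symBmGaugeAt_delta1 (hN : 1 ≤ N) {r : Fin (d + 1) → ℕ} (hr : r ∈ box (d + 1) N) (β : Fin (d + 1)) (z : Fin (d + 1) → ℤ) :
    Summable (symBmGaugeAt (toSite r) (delta1 β z) N) := by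
  classical
  refine summable_of_ne_finset_zero (s := (box (d + 1) N).image fun b => (N : ℤ) • blk N z + toSite b) fun p hp => ?_
  apply symBmGaugeAt_delta1_eq_zero_of_blk_ne hN hr
  intro hblk
  refine hp (Finset.mem_image.2 ⟨off N p, off_mem_box hN p, ?_⟩)
  rw [← hblk]
  exact blk_add_off hN p

end Potential

/-! ## §2 A bounded co-closed row is reproduced by the field block of `Π̂_sym` -/

/-- [folklore] **REPRODUCTION OF A BOUNDED CO-CLOSED ROW BY THE FIELD BLOCK OF `Π̂_sym`** (in-block root, `L ≥ 1`):
`∑'_y ∑_l A_l(y) · piKSymBm ρ L z y (inl β) (inl l) = A_β(z)`. -/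
theorem tsum_mul_piKSymBm_inl_inl {L : ℕ} (hL : 1 ≤ L) {r : Fin (d + 1) → ℕ} (hr : r ∈ box (d + 1) L) {A : Form1 (d + 1) ℝ} {C : ℝ}
    (hA : ∀ l y, |A l y| ≤ C) (hco : codiff₁ A = 0) (z : Fin (d + 1) → ℤ) (β : Fin (d + 1)) :
    ∑' y, ∑ l, A l y * piKSymBm (toSite r) L z y (Sum.inl β) (Sum.inl l) = A β z := by
  have e : ∀ (y : Fin (d + 1) → ℤ) (l : Fin (d + 1)), piKSymBm (toSite r) L z y (Sum.inl β) (Sum.inl l) =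
      delta1 β z l y - dz (symBmGaugeAt (toSite r) (delta1 β z) L) l y := by
    intro y l
    rw [piKSymBm_inl_inl_eq' hL hr]
    unfold symAxProjBmAt
    rw [grad_eq_dz]
    rfl
  simp_rw [e, mul_sub, Finset.sum_sub_distrib]
  have hδ : ∀ y, y ≠ z → ∑ l, A l y * delta1 β z l y = 0 := fun y hy =>
    Finset.sum_eq_zero fun l _ => by rw [delta1_apply, if_neg (fun h => hy h.2), mul_zero]
  have hs1 : Summable fun y => ∑ l, A l y * delta1 β z l y :=
    summable_of_ne_finset_zero (s := {z}) fun y hy => hδ y (by rwa [Finset.mem_singleton] at hy)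
  have hg := summable_symBmGaugeAt_delta1 hL hr β z
  have hs2 : Summable fun y => ∑ l, A l y * dz (symBmGaugeAt (toSite r) (delta1 β z) L) l y :=
    summable_sum fun l _ => summable_mul_of_bdd (hA l) (summable_dz hg l)
  rw [hs1.tsum_sub hs2, tsum_mul_dz_eq_zero_of_codiff₁ hA hco hg, sub_zero, tsum_eq_single z hδ,
    Finset.sum_eq_single β (fun l _ hl => by rw [delta1_apply, if_neg (fun h => hl h.1), mul_zero])
      (fun h => (h (Finset.mem_univ β)).elim),
    delta1_apply, if_pos ⟨rfl, rfl⟩, mul_one]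

/-! ## §3 The straight step candidate is blind to the symmetrised dressing -/

section Step

variable {Lc : ℕ} [NeZero Lc]

/-- [folklore] **RIGHT BLINDNESS OF THE STRAIGHT STEP CANDIDATE TO THE SYMMETRISED DRESSING**:
`comp (bhKStep d Lc (j+1)) (trK (piKSymBm (toSite r) Lc)) = bhKStep d Lc (j+1)` (in-block root). -/
theorem comp_bhKStep_trK_piKSymBm {r : Fin (d + 1) → ℕ} (hr : r ∈ box (d + 1) Lc) (j : ℕ) :
    comp (bhKStep d Lc (j + 1)) (trK (piKSymBm (toSite r) Lc)) = bhKStep d Lc (j + 1) := by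
  have hLc : 1 ≤ Lc := one_le_of_neZero Lc
  obtain ⟨C, hC⟩ := exists_abs_wΦ_le (N := Lc ^ (j + 1)) (d := d)
  funext x z a b
  rcases a with κ | κ
  · have hX : Summable fun y => ∑ l : Fin (d + 1),
        wΦ (N := Lc ^ (j + 1)) κ l (x - y) * trK (piKSymBm (toSite r) Lc) y z (Sum.inl l) b := by
      refine summable_of_ne_finset_zero (s := (cube (d + 1) Lc).image fun v => z + v) fun y hy => ?_
      have hy' : y - z ∉ cube (d + 1) Lc := fun h => hy (Finset.mem_image.2 ⟨y - z, h, by abel⟩)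
      refine Finset.sum_eq_zero fun l _ => ?_
      rw [trK_apply]
      rcases b with β | m
      · rw [piKSymBm_inl_inl, if_neg hy', mul_zero]
      · rw [piKSymBm_inr_inl, mul_zero]
    rw [comp_bhKStep_succ_inl j _ x z κ b hX]
    rcases b with β | m
    · simp only [trK_apply]
      rw [tsum_mul_piKSymBm_inl_inl hLc hr (A := fun l y => wΦ (N := Lc ^ (j + 1)) κ l (x - y)) (fun l y => hC κ l (x - y))
        (codiff₁_wΦ_right κ x) z β, mcol_trK_piKSymBm_inl, contourSumAdj_zero, bhKStep_succ_inl_inl, E2_inl_inl_eq_wΦ]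
      simp only [Pi.zero_apply, mul_zero, sub_zero]
    · simp only [trK_apply, piKSymBm_inr_inl, mul_zero, Finset.sum_const_zero, tsum_zero]
      rw [bhKStep_succ_inl_inr, bhK_inl_inr]
      by_cases hz : Torus.proj Lc z = 0
      · rw [mcol_trK_piKSymBm_inr_of_coarse _ hz, if_pos hz]; ring
      · rw [mcol_trK_piKSymBm_inr_of_not_coarse _ hz, contourSumAdj_zero, if_neg hz]; simp
  · rw [comp_bhKStep_succ_inr]
    rcases b with β | m
    · rw [fcol_trK_piKSymBm_inl hLc hr, contourSum_symAxProjBmAt _ hLc, bhKStep_succ_inr_inl, bhK_inr_inl]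
    · rw [fcol_trK_piKSymBm_inr, contourSum_zero, bhKStep_succ_inr_inr]
      split_ifs <;> simp

/-- [folklore] **LEFT BLINDNESS**: `comp (piKSymBm (toSite r) Lc) (bhKStep d Lc (j+1)) = bhKStep d Lc (j+1)` — by `trK = sgnK`. -/
theorem comp_piKSymBm_bhKStep {r : Fin (d + 1) → ℕ} (hr : r ∈ box (d + 1) Lc) (j : ℕ) :
    comp (piKSymBm (toSite r) Lc) (bhKStep d Lc (j + 1)) = bhKStep d Lc (j + 1) := by
  have h : trK (comp (piKSymBm (toSite r) Lc) (bhKStep d Lc (j + 1))) = trK (bhKStep d Lc (j + 1)) := by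
    rw [trK_comp, trK_bhKStep_succ, ← sgnK_trK_piKSymBm, comp_sgnK, comp_bhKStep_trK_piKSymBm hr]
  have h' := congrArg trK h
  rwa [trK_trK, trK_trK] at h'

end Step

end

end Summit.QuantumFields.BalabanUV.Beta.SymBorderedHessianStepBlind
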